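import Literature.NumberTheory.ComplexMultiplication.CMTypeUniformizationBaseChange
import Literature.NumberTheory.Transcendental.AnalytificationUniquenessProofs
import Literature.NumberTheory.Transcendental.AnalytificationExistenceProofs
import Literature.NumberTheory.Transcendental.AbelianVarietyAnalyticLieGroup
import Literature.AlgebraicGeometry.Motives.AbelianVarietyProjective
import HarnessLib

/-!
# A uniformisation of `(A₀, ι)` of type `(K, Φ, 𝔞)` IS a uniformisation of `(A₀ ⊗_k ℂ, ι ⊗ ℂ)` — the converse of
# `CMTypeUniformization.ofBaseChange` (Shimura 1998, §18.4, §18.6; Serre GAGA §2: `X^h` depends only on `X_ℂ`)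

Topic `Literature/NumberTheory/ComplexMultiplication`, namespace `Literature.NumberTheory.ComplexMultiplication`.
THEOREMS ONLY (every statement `∃`-shaped or a property; no definition, no named fact, no instance; net Literature
debt 0).  Cell `hodgecm-mathlib` (D-0151), fan B-II road E2 toward row F-S2₁′ (`shimuraTaniyamaPair_degOne'`): that
named fact binds uniformisations in the `k`-VARIETY SHAPE `ξ : CMTypeUniformization Φ 𝔞 A ιA` (`A` over the number
field `k ⊆ ℂ`, [Shimura1998] §18.4 (18.4a) «a structure `(A, ι)` defined over a subfield `k` of `ℂ`, of type `(K, Φ, 𝔞)`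
with respect to `ξ`»), whereas the tree's GAGA file `CMTypeUniformizationHoms` §2 (`exists_hom_forall_map_r_eq`: the
`S(γ)` ARE algebraic homomorphisms, [Shimura1998] §7.4 Prop. 15) and the descended-multiplication files
(`CMTypeUniformizationDescendedMultiplications`, `MainTheoremCMLevelQMultiplication`) speak the BASE-CHANGE SHAPE
`CMTypeUniformization Φ 𝔞 (A.baseChange ℂ) ((A.endBaseChange ℂ).comp ιA)`.  The tree has the passage base-change
shape ⇒ `k`-shape (`CMTypeUniformization.ofBaseChange`, file `CMTypeUniformizationBaseChange`); this file supplies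
the converse, so that both apply to the binders of the named fact.

* §1 **`IsAnalytification.pointsEquiv_comp`** — an analytification `φ : M → A₀(ℂ)` of the `k`-scheme `A₀` carrying a
  holomorphic atlas, read through `A₀(ℂ) ≃ (A₀ ⊗_k ℂ)(ℂ)` (`AbelianVariety.pointsEquiv`, Görtz–Wedhorn I §4.7), IS an
  analytification of `A₀ ⊗_k ℂ`.  Proof (Serre, GAGA §2 n°5 Prop. 2, unicité de `X^h`): `A₀ ⊗ ℂ` has SOME
  analytification `ψ : N → (A₀ ⊗ ℂ)(ℂ)` (`exists_isAnalytification_holds`); `pointsEquiv⁻¹ ∘ ψ` is one of `A₀`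
  (`IsAnalytification.pointsEquiv_symm_comp`), hence differs from `φ` by a biholomorphism `h : M ≃ N`
  (`IsAnalytification.unique_holds`), and `pointsEquiv ∘ φ = ψ ∘ h` is an analytification
  (`IsAnalytification.comp_of_isHomeomorph`).
* §2 **`CMTypeUniformization.exists_baseChange_ofBaseChange_eq`** — for `ξ : CMTypeUniformization Φ 𝔞 A₀ ι` there is
  `ξ′ : CMTypeUniformization Φ 𝔞 (A₀.baseChange ℂ) ((A₀.endBaseChange ℂ).comp ι)` with `ofBaseChange ξ′ = ξ`,
  `ξ′ = pointsEquiv ∘ ξ` and `ξ′.r u = pointsEquiv (ξ.r u)` (Shimura's `r = ξ ∘ q` read in `(A₀ ⊗ ℂ)(ℂ)`);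
  `ext_toFun` (a uniformisation is determined by its map), `ofBaseChange_injective`, `ofBaseChange_surjective`.
* §3 the hypothesis «`λ(ξ(q(u))) = η(q(u))`» of the named fact passes to the base-change shape:
  `map_baseChange_r_eq_of_map_r_eq` — if `λ(ξ.r u) = η.r (c u)` for `k`-shape `ξ, η` then
  `(λ ⊗ ℂ)(ξ′.r u) = η′.r (c u)` for the base-change shapes (naturality `pointsEquiv_symm_map_hom`).

## References
* [Shimura1998] G. Shimura, *Abelian Varieties with Complex Multiplication and Modular Functions*, Princeton 1998,
  §18.4 (18.4a) p. 126; §18.6 Thm. 18.6 p. 127 («defined over an algebraic number field»), proof p. 128.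
* [SerreGAGA1956] J.-P. Serre, *Géométrie algébrique et géométrie analytique*, §2 n°5 Prop. 2 (unicité de `X^h`).
* [GortzWedhorn2020] U. Görtz, T. Wedhorn, *Algebraic Geometry I*, 2nd ed., §4.7 (`X(L) = X_L(L)`, functorial in `X`).
-/

noncomputable section

open scoped Manifold ContDiff nonZeroDivisors Classical
open CategoryTheory NumberField Module

/-! ### §1 An analytification of the `k`-scheme `A₀` read as an analytification of `A₀ ⊗_k ℂ` -/

namespace Literature.NumberTheory.Transcendental

open Literature.AlgebraicGeometry.Motives (AbelianVariety AlgPoints ComplexPoints)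
open Literature.AlgebraicGeometry.Motives.AbelianVariety

variable {k : Type} [Field k] [Algebra k ℂ] {A₀ : AbelianVariety k}
  {E : Type*} [NormedAddCommGroup E] [NormedSpace ℂ E] [FiniteDimensional ℂ E]
  {M : Type*} [TopologicalSpace M] [ChartedSpace E M] [IsManifold 𝓘(ℂ, E) ω M]
  {φ : M → ComplexPoints A₀.X}

/-- **An analytification of the `k`-scheme `A₀` (with a holomorphic atlas) is an analytification of `A₀ ⊗_k ℂ`**,
read through `A₀(ℂ) ≃ (A₀ ⊗_k ℂ)(ℂ)` — the converse of `IsAnalytification.pointsEquiv_symm_comp`.  Serre's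
uniqueness of `X^h`: `A₀ ⊗ ℂ` has an analytification `ψ` (`exists_isAnalytification_holds`), `pointsEquiv⁻¹ ∘ ψ`
is one of `A₀`, so `φ = (pointsEquiv⁻¹ ∘ ψ) ∘ h` for a biholomorphism `h` (`unique_holds`) and
`pointsEquiv ∘ φ = ψ ∘ h` is an analytification (`comp_of_isHomeomorph`).
[cite: SerreGAGA1956, §2 n°5 Prop. 2 (unicité de X^h)] [cite: GortzWedhorn2020, §4.7 (X(L) = X_L(L))] -/
theorem IsAnalytification.pointsEquiv_comp (hφ : IsAnalytification E A₀.X A₀.dim φ) :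
    IsAnalytification E (A₀.baseChange ℂ).X (A₀.baseChange ℂ).dim ((A₀.pointsEquiv ℂ) ∘ φ) := by
  haveI : AlgebraicGeometry.SmoothOfRelativeDimension (A₀.baseChange ℂ).dim (A₀.baseChange ℂ).X.hom :=
    smoothOfRelativeDimension_dim _
  -- read all dimensions as `dim (A₀ ⊗ ℂ)` (`= dim A₀`)
  haveI : AlgebraicGeometry.SmoothOfRelativeDimension (A₀.baseChange ℂ).dim A₀.X.hom := by
    rw [AbelianVariety.dim_baseChange]; exact smoothOfRelativeDimension_dim _
  have hφ' : IsAnalytification E A₀.X (A₀.baseChange ℂ).dim φ := by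
    rw [AbelianVariety.dim_baseChange]; exact hφ
  obtain ⟨N, _, _, _, _, ψ, hψ⟩ := exists_isAnalytification_holds (A₀.baseChange ℂ).X (A₀.baseChange ℂ).dim
  -- `pointsEquiv⁻¹ ∘ ψ` is an analytification of `A₀`
  have hψ' := hψ.pointsEquiv_symm_comp
  -- uniqueness of the analytification: `φ = (pointsEquiv⁻¹ ∘ ψ) ∘ h` with `h` biholomorphic
  obtain ⟨h, hh, -, hcomp⟩ := IsAnalytification.unique_holds hφ' hψ'
  have heq : (A₀.pointsEquiv ℂ) ∘ φ = ψ ∘ h := by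
    funext m
    have hm := congrFun hcomp m
    simp only [Function.comp_apply] at hm ⊢
    rw [← hm, Equiv.apply_symm_apply]
  rw [heq]
  exact hψ.comp_of_isHomeomorph h.isHomeomorph hh (by rw [hφ.finrank_eq, hψ.finrank_eq, AbelianVariety.dim_baseChange])

end Literature.NumberTheory.Transcendental

/-! ### §2 `k`-shape uniformisations ⇒ base-change shape -/

namespace Literature.NumberTheory.ComplexMultiplication

open Literature.AlgebraicGeometry.Motives (CMType AbelianVariety AlgPoints)
open Literature.AlgebraicGeometry.Motives.AbelianVariety (pointsEquiv_symm_map pointsEquiv_symm_map_hom)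
open Literature.Geometry.Kaehler
open Literature.Geometry.Kaehler.ComplexTorus (cover mapMatrix)
open Literature.NumberTheory.Transcendental (IsAnalytification)
open CMTypeLattice

namespace CMTypeUniformization

variable {K : Type} [Field K] [NumberField K] {Φ : CMType K} {𝔞 𝔟 : (FractionalIdeal (𝓞 K)⁰ K)ˣ}
  {k : Type} [Field k] [Algebra k ℂ] {A₀ B₀ : AbelianVariety k} {ι : 𝓞 K →+* End A₀} {ι' : 𝓞 K →+* End B₀}

/-- **A uniformisation is determined by its map `ξ : ℂ^Φ/D(𝔞) → A(ℂ)`** (the remaining fields of the record are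
properties). [cite: Shimura1998, §18.4 (18.4a) p. 126] -/
theorem ext_toFun {k' : Type} [Field k'] [Algebra k' ℂ] {A : AbelianVariety k'} {ιA : 𝓞 K →+* End A} :
    ∀ {ξ₁ ξ₂ : CMTypeUniformization Φ 𝔞 A ιA}, ξ₁.toFun = ξ₂.toFun → ξ₁ = ξ₂
  | ⟨_, _, _, _⟩, ⟨_, _, _, _⟩, rfl => rfl

/-- **A uniformisation of `(A₀, ι)` of type `(K, Φ, 𝔞)` is a uniformisation of `(A₀ ⊗_k ℂ, ι ⊗ ℂ)`** (the converse of
`ofBaseChange`): for `ξ : ℂ^Φ/D(𝔞) → A₀(ℂ)` there is `ξ′` of the base-change shape with `ofBaseChange ξ′ = ξ`, namely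
`ξ′ = pointsEquiv ∘ ξ` — «holomorphic isomorphism onto `A₀ ⊗ ℂ`» by `IsAnalytification.pointsEquiv_comp` (Serre: `X^h`
depends only on `X_ℂ`), «group homomorphism» by `pointsMulEquiv`, «`ι(a) ∘ ξ = ξ ∘ Φ(a)`» by the naturality
`pointsEquiv_symm_map`; and Shimura's `r′ = ξ′ ∘ q` is `pointsEquiv ∘ r`.  So the `k`-shape binders `ξ, η` of the named
fact `shimuraTaniyamaPair_degOne'` feed the base-change-shape files (`CMTypeUniformizationHoms` §2,
`CMTypeUniformizationDescendedMultiplications`). [cite: Shimura1998, §18.4 (18.4a) p. 126; §18.6 Thm. 18.6 p. 127]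
[cite: SerreGAGA1956, §2 n°5 Prop. 2] [cite: GortzWedhorn2020, §4.7 (X(L) = X_L(L), functorial in X)] -/
theorem exists_baseChange_ofBaseChange_eq (ξ : CMTypeUniformization Φ 𝔞 A₀ ι) :
    ∃ ξ' : CMTypeUniformization Φ 𝔞 (A₀.baseChange ℂ) ((A₀.endBaseChange ℂ).comp ι),
      ofBaseChange ξ' = ξ ∧ (∀ x, ξ'.toFun x = A₀.pointsEquiv ℂ (ξ.toFun x)) ∧
        ∀ u : K, ξ'.r u = A₀.pointsEquiv ℂ (ξ.r u) := by
  let ξ' : CMTypeUniformization Φ 𝔞 (A₀.baseChange ℂ) ((A₀.endBaseChange ℂ).comp ι) :=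
    { toFun := (A₀.pointsEquiv ℂ) ∘ ξ.toFun
      isAnalytification := ξ.isAnalytification.pointsEquiv_comp
      toFun_add := fun x y => by
        change A₀.pointsMulEquiv ℂ (ξ.toFun (x + y)) =
          A₀.pointsMulEquiv ℂ (ξ.toFun x) * A₀.pointsMulEquiv ℂ (ξ.toFun y)
        rw [ξ.toFun_add, map_mul]
      toFun_mulMatrix := fun a x => by
        change A₀.pointsEquiv ℂ (ξ.toFun (mapMatrix (periodIso Φ 𝔞) (periodIso Φ 𝔞) (mulMatrix 𝔞 a) x)) =
          AlgPoints.map ((A₀.endBaseChange ℂ) (ι a)).hom.hom.hom (A₀.pointsEquiv ℂ (ξ.toFun x))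
        rw [ξ.toFun_mulMatrix]
        apply (A₀.pointsEquiv ℂ).symm.injective
        rw [Equiv.symm_apply_apply, pointsEquiv_symm_map, Equiv.symm_apply_apply] }
  refine ⟨ξ', ext_toFun ?_, fun x => rfl, fun u => rfl⟩
  funext x
  change (A₀.pointsEquiv ℂ).symm (A₀.pointsEquiv ℂ (ξ.toFun x)) = ξ.toFun x
  rw [Equiv.symm_apply_apply]

/-- `ofBaseChange` is injective (both shapes are determined by the map `ξ`). [cite: Shimura1998, §18.4 (18.4a) p. 126] -/
theorem ofBaseChange_injective :
    Function.Injective (ofBaseChange (Φ := Φ) (𝔞 := 𝔞) (A₀ := A₀) (ι := ι)) := by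
  intro ξ₁ ξ₂ h
  refine ext_toFun (funext fun x => (A₀.pointsEquiv ℂ).symm.injective ?_)
  change (ofBaseChange ξ₁).toFun x = (ofBaseChange ξ₂).toFun x
  rw [h]

/-- `ofBaseChange` is surjective: every `k`-shape uniformisation comes from a base-change-shape one.
[cite: Shimura1998, §18.4 (18.4a) p. 126] [cite: SerreGAGA1956, §2 n°5 Prop. 2] -/
theorem ofBaseChange_surjective :
    Function.Surjective (ofBaseChange (Φ := Φ) (𝔞 := 𝔞) (A₀ := A₀) (ι := ι)) := fun ξ => by
  obtain ⟨ξ', h, -⟩ := exists_baseChange_ofBaseChange_eq ξ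
  exact ⟨ξ', h⟩

/-- `(A₀ ⊗ ℂ, ι ⊗ ℂ)` is of type `(K, Φ, 𝔞)` as soon as `(A₀, ι)` is (converse of `nonempty_of_baseChange`).
[cite: Shimura1998, §18.4 (18.4a) p. 126] -/
theorem nonempty_baseChange_of (h : Nonempty (CMTypeUniformization Φ 𝔞 A₀ ι)) :
    Nonempty (CMTypeUniformization Φ 𝔞 (A₀.baseChange ℂ) ((A₀.endBaseChange ℂ).comp ι)) :=
  h.elim fun ξ => (ofBaseChange_surjective ξ).nonempty

/-! ### §3 The diagram «`λ ∘ ξ ∘ q = η ∘ q`» in the two shapes -/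

/-- **The relation «`λ(r(u)) = r′(c u)`» passes from the `k`-shape to the base-change shape**: if a `k`-homomorphism
`λ : A₀ → B₀` satisfies `λ((ofBaseChange ξ).r u) = (ofBaseChange η).r v` then `(λ ⊗ ℂ)(ξ.r u) = η.r v` (naturality of
`A₀(ℂ) ≃ (A₀ ⊗ ℂ)(ℂ)` in `A₀`, `pointsEquiv_symm_map_hom`); the converse is `ofBaseChange_r_of_map_baseChange_r_eq`.
[cite: Shimura1998, §18.6 proof of Thm. 18.6 (≈ p. 128, the diagram with the isogenies λ and μ)] [cite: GortzWedhorn2020, §4.7] -/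
theorem map_baseChange_r_eq_of_ofBaseChange_r
    (ξ : CMTypeUniformization Φ 𝔞 (A₀.baseChange ℂ) ((A₀.endBaseChange ℂ).comp ι))
    (η : CMTypeUniformization Φ 𝔟 (B₀.baseChange ℂ) ((B₀.endBaseChange ℂ).comp ι')) (lam : A₀ ⟶ B₀) (u v : K)
    (hlam : AlgPoints.map lam.hom.hom.hom ((ofBaseChange ξ).r u) = (ofBaseChange η).r v) :
    AlgPoints.map (AbelianVariety.Hom.baseChange ℂ lam).hom.hom.hom (ξ.r u) = η.r v := by
  apply (B₀.pointsEquiv ℂ).symm.injective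
  rw [pointsEquiv_symm_map_hom, ← ofBaseChange_r, ← ofBaseChange_r, hlam]

/-- **From the named fact's binders to the base-change shape**: for `k`-shape uniformisations `ξ, η` of `(A₀, ι)`,
`(B₀, ι′)` and a `k`-homomorphism `λ` with `λ(ξ.r u) = η.r (c u)` for all `u` (the hypothesis `_hlam` of
`shimuraTaniyamaPair_degOne'` is `c = 1`), there are base-change-shape uniformisations `ξ′, η′` over `ξ, η` with
`(λ ⊗ ℂ)(ξ′.r u) = η′.r (c u)` — the currency of `CMTypeUniformizationDescendedMultiplications`
(`hom_eq_of_forall_baseChange_map_r_eq`, `comp_eq_of_forall_baseChange_map_r_eq`, …) and of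
`MainTheoremCMLevelQMultiplication`. [cite: Shimura1998, §18.6 proof of Thm. 18.6 (≈ p. 128)] [cite: SerreGAGA1956, §2 n°5 Prop. 2] -/
theorem exists_baseChange_map_baseChange_r_eq (ξ : CMTypeUniformization Φ 𝔞 A₀ ι)
    (η : CMTypeUniformization Φ 𝔟 B₀ ι') (lam : A₀ ⟶ B₀) (c : K)
    (hlam : ∀ u : K, AlgPoints.map lam.hom.hom.hom (ξ.r u) = η.r (c * u)) :
    ∃ (ξ' : CMTypeUniformization Φ 𝔞 (A₀.baseChange ℂ) ((A₀.endBaseChange ℂ).comp ι))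
      (η' : CMTypeUniformization Φ 𝔟 (B₀.baseChange ℂ) ((B₀.endBaseChange ℂ).comp ι')),
      ofBaseChange ξ' = ξ ∧ ofBaseChange η' = η ∧
        ∀ u : K, AlgPoints.map (AbelianVariety.Hom.baseChange ℂ lam).hom.hom.hom (ξ'.r u) = η'.r (c * u) := by
  obtain ⟨ξ', hξ, -⟩ := exists_baseChange_ofBaseChange_eq ξ
  obtain ⟨η', hη, -⟩ := exists_baseChange_ofBaseChange_eq η
  refine ⟨ξ', η', hξ, hη, fun u => map_baseChange_r_eq_of_ofBaseChange_r ξ' η' lam u (c * u) ?_⟩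
  rw [hξ, hη, hlam]

end CMTypeUniformization

end Literature.NumberTheory.ComplexMultiplication

end
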